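import Summits.BirchSwinnertonDyer.BirchSwinnertonDyer.Theorems.InertBadSignedBranchesCccOneLawOnTypeIstarZeroOfEtaGZ
import Summits.BirchSwinnertonDyer.Rank1Residual.X12.ClassClosureO10ReadingsPeriodFact
import HarnessLib

/-!
# Route `InertBadSignedBranches` (rung K8), crux `CccOneLawOnTypeIstarZero`: the η-branch `p`-adic
# Gross–Zagier VALUATION identity (GZ_η-VAL) PER PAIR and the O10-PS statements of record read on it
# (helper toward stmt-BirchSwinnertonDyer-19223; cell bsd-cm, seat bsd-cm-inert g10; nothing asserted)

The sibling `Theorems/InertBadSignedBranchesCccOneLawOnTypeIstarZeroOfEtaGZ.lean` (p410221) proves the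
EQUIVALENCE of the crux `CccOneLawOnTypeIstarZero` (all `p ≥ 5`, all `W` of signed type `(p, I₀*)`)
with (GZ_η-VAL) in PRINT CURRENCY — `coeff₁ L ≠ 0 ∧ v_p(coeff₁ L_p⁻(V, η, X)) = 2·ord_p log_ω(P) +
ord_p(L′(W,1)/(Ω_W·Reg W))` for every twin datum and generator `P` — through the kernel identification
`EtaGZ.valuation_padicLog_eq_level` (`ord_p log_ω(P)` = the `p`-divisibility level). THIS FILE gives the
PER-PAIR and PER-PRIME forms the cell's statements of record use:

* §1 `quadraticBranchPAdicGrossZagierValuationAt_of_etaGZValuationAt` / `etaGZValuationAt_of_…` —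
  at ONE pair `(W, p)` on the type: C-cc-1 `Additive.QuadraticBranchPAdicGrossZagierValuationAt W p` ⟺
  (GZ_η-VAL) at `(W, p)`;
* §2 `lowerHalfOnType_IstarZero_of_etaGZValuation_of_lowerReading_of_mazur` — THE O10-PS CLASS NODE OF
  RECORD (p405275, `X12.O10.lowerHalfOnType_IstarZero_of_valuation_of_lowerReading_of_mazur`) with its
  C-cc-1 input REPLACED by (GZ_η-VAL) on the type at `p`: `LowerHalfOnType p I₀*` ⟸ (GZ_η-VAL) on the
  type ∧ (C1_η) on the CM good-inert curves ∧ `hmod hGZ hGZK hPT hnf` ∧ Mazur's `p ∤ c_Manin` (`hM`) ∧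
  the LOWER Kobayashi-7.4 reading; and `bsdp_of_hasSignedLocalType_IstarZero_of_etaGZValuation_of_readings_of_mazur`
  — pair-level `BSD(W, p)` from (GZ_η-VAL) at `(W, p)`, (C1_η), the readings (R2) + exact 7.4, the named
  facts and `hM`.

HONEST STATUS: (GZ_η-VAL) is the cell's OWN statement (the valuation content of N7-LEDGER §5
(C2_η-VAL)^{≐} / R98; derived ON PAPER from (GZ_η) = Howard 2005 ∘ Kobayashi 2013 + Prop 2.19_η +
PROP 5.6_η, memos N3 / N6-PROOF / N7, referee REF-4 PASS; in NO source) — a HYPOTHESIS in every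
theorem below; (C1_η) is conjecture-grade; the readings are hypothesis texts; nothing is booked; no
label moves; the crux and O10 stay OPEN.
[cite: Kobayashi2003, §3 (3.5)–(3.7) (p. 7), §4 (p. 8), Thm. 7.4 (p. 13)]
[cite: Kobayashi2013, Cor. 1.3–1.4 and Cor. 4.9 (shape at good p)] [cite: Mazur1978, Cor. 4.1]
[cite: Miller2011LMS, §1 and Def. 1.1]
-/

set_option autoImplicit false
set_option linter.dupNamespace false

noncomputable section

open scoped Classical MatrixGroups ModularForm NumberField

open CongruenceSubgroup Field WeierstrassCurve
open Literature.NumberTheory.EllipticCurves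
open Literature.NumberTheory.EllipticCurves.ModularForms
open Literature.NumberTheory.EllipticCurves.Kobayashi2003 hiding IsQuadraticBranchMinusLFunction
open Literature.NumberTheory.EllipticCurves.Rank1Residual
open Literature.NumberTheory.EllipticCurves.Rank1Residual.Typed
open Literature.NumberTheory.GaloisRepresentations
open Literature.NumberTheory.GaloisCohomology
open Summit.BirchSwinnertonDyer.Rank1Residual
open Summit.BirchSwinnertonDyer.Rank1Residual.Additive
open Summit.BirchSwinnertonDyer.Rank1Residual.Additive.LocalLog
open Summit.BirchSwinnertonDyer.Rank1Residual.X12.O10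

namespace Summit.BirchSwinnertonDyer.BirchSwinnertonDyer.Theorems.EtaGZ

variable (W : WeierstrassCurve ℚ) [W.IsElliptic] [W.IsGloballyMinimal] (p : ℕ) [hp : Fact p.Prime]

/-! ## §1 Per pair: C-cc-1 at `(W, p)` ⟺ (GZ_η-VAL) at `(W, p)` -/

/-- **C-cc-1 at the pair `(W, p)` on the type `(p, I₀*)`, `p ≥ 5`, FROM (GZ_η-VAL) at `(W, p)`**
(`hGZ`: for every twin datum `(V, C, f, ϖ, L)` of `W`, every generator `P` of `W(ℚ)/tors` and every
`q` with `L′(W,1)/(Ω_W·Reg W) = q`: `coeff₁ L ≠ 0 ∧ v_p(coeff₁ L) = 2·v_p(log_ω(P)) + ord_p q`). The law's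
divisibility level `n` of `P` in `W(ℚ_p)` is `v_p(log_ω(P))` by `valuation_padicLog_eq_level` (`W` is
additive at `p` with `p ∤ c_p` on the type, §3 of the sibling; `W(ℚ_p)[p] = 0` is the law's own
hypothesis). CONDITIONAL on `hGZ` (OUR statement, in no source); nothing booked.
[cite: Kobayashi2003, §3 (3.5)–(3.7) (p. 7), §4 (p. 8)] [cite: SilvermanAEC2009, IV.6.4 and VII.6.3] -/
theorem quadraticBranchPAdicGrossZagierValuationAt_of_etaGZValuationAt (hp5 : 5 ≤ p)
    (hT : HasSignedLocalType W p (.Istar 0))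
    (hGZ : ∀ (V : WeierstrassCurve ℚ) [V.IsElliptic] [V.IsGloballyMinimal] (C : VariableChange ℚ)
        {N : ℕ} [NeZero N] {f : CuspForm (Gamma0 N) 2},
        C • W.quadraticTwist ((-1) ^ (p / 2) * p) = V →
        V.HasGoodReductionAtPrime p → V.frobeniusTrace p = 0 → IsNewformOf V f →
        ∀ (ϖ : ℚ), (if Even (p / 2) then (ϖ : ℝ) * V.realPeriodRat = plusPeriod f
            else (ϖ : ℝ) * V.imaginaryPeriodRat = minusPeriod f) →
        ∀ (L : IwasawaAlgebra p), IsQuadraticBranchMinusLFunction f p ϖ L →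
        ∀ (P : W.toAffine.Point), ¬ IsOfFinAddOrder P →
        (∀ R : W.toAffine.Point, ∃ (k : ℤ) (T : W.toAffine.Point), IsOfFinAddOrder T ∧ R = k • P + T) →
        ∀ (q : ℚ), W.leadingLCoeff / ((W.realPeriodRat * W.regulator : ℝ) : ℂ) = (q : ℂ) →
        PowerSeries.coeff 1 L ≠ 0 ∧
          ((PowerSeries.coeff 1 L : ℤ_[p]) : ℚ_[p]).valuation =
            2 * (padicLog (W.baseChange ℚ_[p]) (W.toPadicPoint p P)).valuation + padicValRat p q) :
    QuadraticBranchPAdicGrossZagierValuationAt W p := by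
  rw [quadraticBranchPAdicGrossZagierValuationAt_iff_leadingTerm]
  intro V _ _ C N _ f _ hCV hgood hap _ hf ϖ hϖ L hL htors P n hP hgen hdiv hndiv q hq
  have hp2 : p ≠ 2 := by omega
  obtain ⟨hne, hv⟩ := hGZ V C hCV hgood hap hf ϖ hϖ L hL P hP hgen q hq
  obtain ⟨-, hlev⟩ := valuation_padicLog_eq_level W p
    (addv_of_hasSignedLocalType_of_twist_good W hT hp2 C hCV hgood)
    (not_dvd_localTamagawaNumber_of_twist_good W hp5 C hCV hgood) htors hdiv hndiv
  rw [hlev] at hv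
  exact ⟨hne, hv⟩

/-- **Conversely, C-cc-1 at `(W, p)` gives (GZ_η-VAL) at `(W, p)`** (the pair form of the sibling's
`etaGZValuation_of_cccOneLawOnTypeIstarZero`): the image of a generator in `W(ℚ_p)` has some
`p`-divisibility level (`StrictSha.exists_level_of_not_isOfFinAddOrder`; `W(ℚ_p)[p] = 0` by
`eq_zero_of_prime_smul_eq_zero_padic_of_quadraticTwist_goodSupersingular`), the law evaluates there, and
the level is `v_p(log_ω(P))`. So the two statements are EQUIVALENT pair by pair. Bookkeeping; nothing booked.
[cite: Kobayashi2003, §3 (3.5)–(3.7) (p. 7), §4 (p. 8)] [cite: SilvermanAEC2009, IV.6.4 and VII.6.3] -/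
theorem etaGZValuationAt_of_quadraticBranchPAdicGrossZagierValuationAt (hp5 : 5 ≤ p)
    (hT : HasSignedLocalType W p (.Istar 0)) (hr : W.analyticRank = 1)
    (h2 : QuadraticBranchPAdicGrossZagierValuationAt W p)
    (V : WeierstrassCurve ℚ) [V.IsElliptic] [V.IsGloballyMinimal] (C : VariableChange ℚ)
    {N : ℕ} [NeZero N] {f : CuspForm (Gamma0 N) 2}
    (hCV : C • W.quadraticTwist ((-1) ^ (p / 2) * p) = V)
    (hgood : V.HasGoodReductionAtPrime p) (hap : V.frobeniusTrace p = 0) (hf : IsNewformOf V f)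
    (ϖ : ℚ) (hϖ : if Even (p / 2) then (ϖ : ℝ) * V.realPeriodRat = plusPeriod f
        else (ϖ : ℝ) * V.imaginaryPeriodRat = minusPeriod f)
    (L : IwasawaAlgebra p) (hL : IsQuadraticBranchMinusLFunction f p ϖ L)
    (P : W.toAffine.Point) (hP : ¬ IsOfFinAddOrder P)
    (hgen : ∀ R : W.toAffine.Point, ∃ (k : ℤ) (T : W.toAffine.Point), IsOfFinAddOrder T ∧ R = k • P + T)
    (q : ℚ) (hq : W.leadingLCoeff / ((W.realPeriodRat * W.regulator : ℝ) : ℂ) = (q : ℂ)) :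
    PowerSeries.coeff 1 L ≠ 0 ∧
      ((PowerSeries.coeff 1 L : ℤ_[p]) : ℚ_[p]).valuation =
        2 * (padicLog (W.baseChange ℚ_[p]) (W.toPadicPoint p P)).valuation + padicValRat p q := by
  -- adapted from the sibling's `etaGZValuation_of_cccOneLawOnTypeIstarZero`, the crux replaced by `h2`
  have hp2 : p ≠ 2 := by omega
  have htors := eq_zero_of_prime_smul_eq_zero_padic_of_quadraticTwist_goodSupersingular hp2 W C V hCV
    hgood hap
  obtain ⟨lam, hlam⟩ := exists_addMonoidHom_padicInt_apply_eq_zero_iff p (W.baseChange ℚ_[p])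
  have hinj : Function.Injective (W.toPadicPoint p) :=
    Affine.Point.map_injective (W' := W) (Algebra.ofId ℚ ℚ_[p])
  have hPp : ¬ IsOfFinAddOrder (W.toPadicPoint p P) := by
    intro h'
    apply hP
    obtain ⟨m, hm, hmP⟩ := isOfFinAddOrder_iff_nsmul_eq_zero.mp h'
    refine isOfFinAddOrder_iff_nsmul_eq_zero.mpr ⟨m, hm, hinj ?_⟩
    rw [map_nsmul, map_zero]
    exact hmP
  obtain ⟨n, hdiv, hndiv⟩ := StrictSha.exists_level_of_not_isOfFinAddOrder p lam hlam hPp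
  have h2' := (quadraticBranchPAdicGrossZagierValuationAt_iff_leadingTerm W p).mp h2
    V C hp5 hCV hgood hap hr hf ϖ hϖ L hL htors P n hP hgen hdiv hndiv q hq
  obtain ⟨-, hlev⟩ := valuation_padicLog_eq_level W p
    (addv_of_hasSignedLocalType_of_twist_good W hT hp2 C hCV hgood)
    (not_dvd_localTamagawaNumber_of_twist_good W hp5 C hCV hgood) htors hdiv hndiv
  rw [hlev]
  exact h2'

/-! ## §2 The O10-PS statements of record read on (GZ_η-VAL) -/

variable {W}

/-- **THE O10-PS CLASS NODE OF RECORD ON (GZ_η-VAL): `LowerHalfOnType p I₀*`, `p ≥ 5`** ⟸ (GZ_η-VAL)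
on every rank-one CM curve of signed type `(p, I₀*)` (`hGZ`) ∧ (C1_η) on the CM good-inert curves
(`hC1`) ∧ the named facts `hmod hGZfact hGZK hPT hnf` and Mazur's `p ∤ c_Manin` (`hM`) ∧ the LOWER
Kobayashi-7.4 reading on the type (`h74l`) — the node p405275
(`X12.O10.lowerHalfOnType_IstarZero_of_valuation_of_lowerReading_of_mazur`) with C-cc-1 supplied by §1.
CONDITIONAL on every displayed hypothesis; nothing booked; no label moves; O10 stays OPEN.
[cite: Mazur1978, Cor. 4.1] [cite: Kobayashi2003, §4 (p. 8), Thm. 7.4 (p. 13), Thm. 3.2 (p. 7)]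
[cite: Miller2011LMS, Def. 1.1] -/
theorem lowerHalfOnType_IstarZero_of_etaGZValuation_of_lowerReading_of_mazur
    (hmod : hasEntireLFunction_rat) (hGZfact : GrossZagier1986_thm_I_7_3)
    (hGZK : rank_eq_analyticRank_of_analyticRank_le_one)
    (hPT : poitouTate_selmerStructure_duality_real ℚ) (hnf : exists_isNewformOf)
    (hM : mazur_not_dvd_maninConstant_of_odd)
    (hGZ : ∀ (W : WeierstrassCurve ℚ) [W.IsElliptic] [W.IsGloballyMinimal],
      HasSignedLocalType W p (.Istar 0) → W.analyticRank = 1 →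
      ∀ (V : WeierstrassCurve ℚ) [V.IsElliptic] [V.IsGloballyMinimal] (C : VariableChange ℚ)
        {N : ℕ} [NeZero N] {f : CuspForm (Gamma0 N) 2},
        C • W.quadraticTwist ((-1) ^ (p / 2) * p) = V →
        V.HasGoodReductionAtPrime p → V.frobeniusTrace p = 0 → IsNewformOf V f →
        ∀ (ϖ : ℚ), (if Even (p / 2) then (ϖ : ℝ) * V.realPeriodRat = plusPeriod f
            else (ϖ : ℝ) * V.imaginaryPeriodRat = minusPeriod f) →
        ∀ (L : IwasawaAlgebra p), IsQuadraticBranchMinusLFunction f p ϖ L →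
        ∀ (P : W.toAffine.Point), ¬ IsOfFinAddOrder P →
        (∀ R : W.toAffine.Point, ∃ (k : ℤ) (T : W.toAffine.Point), IsOfFinAddOrder T ∧ R = k • P + T) →
        ∀ (q : ℚ), W.leadingLCoeff / ((W.realPeriodRat * W.regulator : ℝ) : ℂ) = (q : ℂ) →
        PowerSeries.coeff 1 L ≠ 0 ∧
          ((PowerSeries.coeff 1 L : ℤ_[p]) : ℚ_[p]).valuation =
            2 * (padicLog (W.baseChange ℚ_[p]) (W.toPadicPoint p P)).valuation + padicValRat p q)
    (h74l : ∀ (W : WeierstrassCurve ℚ) [W.IsElliptic] [W.IsGloballyMinimal],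
      HasSignedLocalType W p (.Istar 0) → W.analyticRank = 1 →
      ∀ (V : WeierstrassCurve ℚ) [V.IsElliptic] [V.IsGloballyMinimal] (C : VariableChange ℚ)
        {N : ℕ} [NeZero N] {f : CuspForm (Gamma0 N) 2},
        p ≠ 2 → C • W.quadraticTwist ((-1) ^ (p / 2) * p) = V →
        V.HasGoodReductionAtPrime p → V.frobeniusTrace p = 0 →
        QuadraticBranchPlusMainConjectureAt V p → IsNewformOf V f →
        ∀ (ϖ : ℚ), (if Even (p / 2) then (ϖ : ℝ) * V.realPeriodRat = plusPeriod f
            else (ϖ : ℝ) * V.imaginaryPeriodRat = minusPeriod f) →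
        ∀ (Lη : IwasawaAlgebra p), IsQuadraticBranchMinusLFunction f p ϖ Lη →
        ∀ (κ : ZpExtension ℚ p) (γ : Field.absoluteGaloisGroup ℚ),
          κ.IsCyclotomic → κ.IsTopGenerator γ → IsCyclotomicVariable p γ →
        ∀ (D : StrictSignedSelmerDualData W κ ℚ_[p] γ (-1)) (L' : IwasawaAlgebra p),
          Lη = PowerSeries.X * L' → D.charIdeal ≤ Ideal.span {L'})
    (hC1 : ∀ (V : WeierstrassCurve ℚ) [V.IsElliptic] [V.IsGloballyMinimal], V.HasCM →
      V.HasGoodReductionAtPrime p → CMInert V p → QuadraticBranchPlusMainConjectureAt V p)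
    (hp5 : 5 ≤ p) : LowerHalfOnType p (.Istar 0) :=
  lowerHalfOnType_IstarZero_of_valuation_of_lowerReading_of_mazur hmod hGZfact hGZK hPT hnf hM
    (fun W _ _ hT hr ↦ quadraticBranchPAdicGrossZagierValuationAt_of_etaGZValuationAt W p hp5 hT
      (hGZ W hT hr))
    h74l hC1 hp5

variable (W)

/-- **`BSD(W, p)` at a rank-one CM pair of signed type `(p, I₀*)`, `p ≥ 5`, FROM (GZ_η-VAL) at `(W, p)`**
(`hGZ`), (C1_η) on the good twins, the readings (R2) (`hR2`, typed) and `h74x` (exact Kobayashi 7.4 at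
`η`), the named facts and Mazur's `p ∤ c_Manin` — the pair consumer p405275
(`bsdp_of_hasSignedLocalType_IstarZero_of_valuation_of_readings_of_mazur`) with C-cc-1 supplied by §1.
CONDITIONAL; nothing booked. [cite: Mazur1978, Cor. 4.1] [cite: Kobayashi2003, §4 (p. 8), Thm. 7.4 (p. 13)]
[cite: KitajimaOtsuki2018, Main Thm. 1.3 (arXiv:1607.03612 p. 3)] [cite: Miller2011LMS, §1 and Def. 1.1] -/
theorem bsdp_of_hasSignedLocalType_IstarZero_of_etaGZValuationAt_of_readings_of_mazur
    (hmod : hasEntireLFunction_rat) (hGZfact : GrossZagier1986_thm_I_7_3)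
    (hGZK : rank_eq_analyticRank_of_analyticRank_le_one)
    (hPT : poitouTate_selmerStructure_duality_real ℚ) (hnf : exists_isNewformOf)
    (hM : mazur_not_dvd_maninConstant_of_odd)
    (hC1 : ∀ (V : WeierstrassCurve ℚ) [V.IsElliptic] [V.IsGloballyMinimal], V.HasCM →
      V.HasGoodReductionAtPrime p → CMInert V p → QuadraticBranchPlusMainConjectureAt V p)
    (hGZ : ∀ (V : WeierstrassCurve ℚ) [V.IsElliptic] [V.IsGloballyMinimal] (C : VariableChange ℚ)
        {N : ℕ} [NeZero N] {f : CuspForm (Gamma0 N) 2},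
        C • W.quadraticTwist ((-1) ^ (p / 2) * p) = V →
        V.HasGoodReductionAtPrime p → V.frobeniusTrace p = 0 → IsNewformOf V f →
        ∀ (ϖ : ℚ), (if Even (p / 2) then (ϖ : ℝ) * V.realPeriodRat = plusPeriod f
            else (ϖ : ℝ) * V.imaginaryPeriodRat = minusPeriod f) →
        ∀ (L : IwasawaAlgebra p), IsQuadraticBranchMinusLFunction f p ϖ L →
        ∀ (P : W.toAffine.Point), ¬ IsOfFinAddOrder P →
        (∀ R : W.toAffine.Point, ∃ (k : ℤ) (T : W.toAffine.Point), IsOfFinAddOrder T ∧ R = k • P + T) →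
        ∀ (q : ℚ), W.leadingLCoeff / ((W.realPeriodRat * W.regulator : ℝ) : ℂ) = (q : ℂ) →
        PowerSeries.coeff 1 L ≠ 0 ∧
          ((PowerSeries.coeff 1 L : ℤ_[p]) : ℚ_[p]).valuation =
            2 * (padicLog (W.baseChange ℚ_[p]) (W.toPadicPoint p P)).valuation + padicValRat p q)
    (hR2 : OddBranchStrictMinusNoFiniteSubmoduleAt W p)
    (h74x : ∀ (V : WeierstrassCurve ℚ) [V.IsElliptic] [V.IsGloballyMinimal] (C : VariableChange ℚ)
        {N : ℕ} [NeZero N] {f : CuspForm (Gamma0 N) 2},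
        p ≠ 2 → C • W.quadraticTwist ((-1) ^ (p / 2) * p) = V →
        V.HasGoodReductionAtPrime p → V.frobeniusTrace p = 0 →
        QuadraticBranchPlusMainConjectureAt V p → IsNewformOf V f →
        ∀ (ϖ : ℚ), (if Even (p / 2) then (ϖ : ℝ) * V.realPeriodRat = plusPeriod f
            else (ϖ : ℝ) * V.imaginaryPeriodRat = minusPeriod f) →
        ∀ (Lη : IwasawaAlgebra p), IsQuadraticBranchMinusLFunction f p ϖ Lη →
        ∀ (κ : ZpExtension ℚ p) (γ : Field.absoluteGaloisGroup ℚ),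
          κ.IsCyclotomic → κ.IsTopGenerator γ → IsCyclotomicVariable p γ →
        ∀ (D : StrictSignedSelmerDualData W κ ℚ_[p] γ (-1)) (L' : IwasawaAlgebra p),
          Lη = PowerSeries.X * L' → D.charIdeal = Ideal.span {L'})
    (hT : HasSignedLocalType W p (.Istar 0)) (hr : W.analyticRank = 1) (hp5 : 5 ≤ p) :
    BSDp W p :=
  bsdp_of_hasSignedLocalType_IstarZero_of_valuation_of_readings_of_mazur hmod hGZfact hGZK hPT hnf hM
    hC1 W (quadraticBranchPAdicGrossZagierValuationAt_of_etaGZValuationAt W p hp5 hT hGZ) hR2 h74x hT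
    hr hp5

end Summit.BirchSwinnertonDyer.BirchSwinnertonDyer.Theorems.EtaGZ

end
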